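import Literature.Geometry.Lorentzian.DecaySymbols
import Literature.Geometry.Lorentzian.MassCapacity
import Literature.Geometry.Lorentzian.PositiveMassConformal
import HarnessLib

/-!
# Schoen–Yau 1979, Cor. 3.1: the conformal deformation to negative mass, decomposed

`Literature.Geometry.Lorentzian.PositiveMassRigidity` reduces step 1 of the rigidity theorem,
the named fact `scalarFlat_of_massZero` (Schoen–Yau, Comm. Math. Phys. 65 (1979), p. 72:
"Theorem 1 and Corollary 3.1 imply that an asymptotically flat metric satisfying the hypotheses
`M = 0`, `R ≥ 0` must have `R = 0` on `N`"), to Thm. 1 (`schoenYau_mass_nonneg`, the positive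
mass theorem) and Cor. 3.1 (`exists_conformal_negativeMass_of_massZero`: if `M = 0`, `R ≥ 0`,
`R ≢ 0`, some conformal metric `φ⁴ ds²` is asymptotically flat, scalar flat and of negative
mass). This file decomposes Cor. 3.1 along the structure of its printed proof (Lemma 3.3 with
Lemma 3.2, pp. 64–72) into

1. the **elliptic core**: the positive solution `φ` of `Δφ - Rφ/8 = 0` ((3.22)) with
   `φ = 1 + A/r + ω`, `ω = O₂(r⁻²)` ((3.17)–(3.18), Schauder (3.20)) and
   `A = -(1/32π) ∫_N Rφ dV < 0` ((3.16));
2. the **conformal scalar-curvature formula** in dimension three: `R(φ⁴h) = φ⁻⁵ (Rφ - 8Δφ)`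
   (p. 49, "well-known");
3. the **mass of `φ⁴ ds²`** (p. 49 and p. 72: "The formula for `M̃` follows from Lemma 3.2"):
   if `h` has the expansion (1.1) with mass `M` and `φ = 1 + A/r + O₂(r⁻²)`, then `φ⁴ h` has
   the expansion (1.1) with mass `M + 2A`. This step is **proved** here
   (`IsAsymptoticallySchwarzschild.conformal`), by the symbol calculus of `DecaySymbols.lean`
   (`isBigOSmooth_conformalFourth_chart`) and the identity
   `hCoeff e (D.conformal φ) = (endValue e φ)⁴ • hCoeff e D` on the end
   (`AFEnd.hCoeff_conformal` of `PositiveMassConformal.lean`, restated with `endValue`); the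
   smoothness of the chart components of the metric it consumes is the discharged prelude fact
   `AFEnd.ContDiffOn_hCoeff` (`AFEnd.ContDiffOn_hCoeff_holds`, `AsymptoticFlatnessProofs.lean`);

and proves Cor. 3.1 from 1–3, steps 1 and 2 entering as explicit hypotheses whose statements are
spelled out with the source's numbering — they are used, not asserted
(`exists_conformal_negativeMass_of_conformalFactor`: the metric `φ⁴ h` is the conformal data
`D.conformal φ` of `PositiveMassConformal.lean`, scalar flat by 1 and 2, of mass `2A < 0` by 1
and 3; `exists_conformal_negativeMass_of_massZero_of_conformalFactor`), hence
`scalarFlat_of_massZero` from Thm. 1 and 1–3 (`scalarFlat_of_massZero_of_conformalFactor`).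
Scalar functions are read in the chart of the end through `endValue` of `MassCapacity.lean`
(junk value `0` inside the ball), for which the multiplicativity and smoothness lemmas are added
here.

## Design

* The two hypotheses quantify over the data exactly like the facts of `PositiveMassRigidity`
  (`X : Type`, `D : InitialDataSet (𝓡 3) X`, `e : AFEnd X`, hypotheses `IsOrientable`,
  `IsStronglyAsymptoticallyFlatWith D 0 2 0 5 0`, `IsSoleEnd`, `R ≥ 0`), so that the assembly is
  logic plus the proved step 3. The elliptic core is stated for `M = 0` only, as Lemma 3.2 is
  printed ("Suppose (1.1) holds and `N_k` has zero total mass"), and requires of the mass term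
  only its sign `A < 0` — which is what Cor. 3.1 prints ("`N_k` has negative total mass") and all
  that its use consumes; the docstrings record the printed formula (3.16) for `A`.
* The Laplace–Beltrami operator is the prelude's `PseudoRiemannianMetric.dalembertian`
  (`tr_h Hess`, O'Neill 1983, Def. 3.50), the scalar curvature `PseudoRiemannianMetric.scalarCurvature`;
  both metrics' `[HasLeviCivita]` hypotheses are discharged by `PseudoRiemannianMetric.hasLeviCivita`.
* Smoothness of `φ` is part of the elliptic core: for smooth `ds²`, (3.22) is a linear elliptic
  equation with smooth coefficients (the source, working with `C⁵` metrics, gets `φ ∈ C^{2,λ}`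
  from "standard linear theory [17]"); it is needed to form the smooth metric `φ⁴ h`.
* What is deliberately NOT here: Lemmas 3.1–3.2 themselves (weighted Sobolev inequality and linear
  theory on `N`), the general-mass version of Lemma 3.3, and the Ricci variation of pp. 72–74.

## References

* R. Schoen, S.-T. Yau, *On the proof of the positive mass conjecture in general relativity*,
  Comm. Math. Phys. 65 (1979) 45–76: §2 Step 1 (pp. 48–49), Lemmas 3.1–3.3 and Cor. 3.1
  (pp. 63–72), in particular (3.16)–(3.18), (3.20), (3.22)–(3.23).
* R. Schoen, *Variational theory for the total scalar curvature functional for Riemannian metrics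
  and related topics*, in: Topics in Calculus of Variations (Montecatini Terme 1987), Lecture Notes
  in Math. 1365, Springer 1989, §4, proof of Prop. 4.1 (`u = 1 + A|x|^{2-n} + O(|x|^{1-n})`,
  "the metric `u^{4/(n-2)} g` is then scalar flat and has total energy `E(g) + A`").
* R. Bartnik, *The mass of an asymptotically flat manifold*, CPAM 39 (1986), §1.
* B. O'Neill, *Semi-Riemannian geometry*, Academic Press 1983, Ch. 3, Def. 3.50.
-/

noncomputable section

open Bundle Set Manifold TopologicalSpace Filter Asymptotics Module Bornology
open scoped ContDiff Topology Manifold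

namespace Literature.Geometry.Lorentzian

/-! ### Scalar functions read in the chart of an end -/

section EndValue

variable {X : Type} [TopologicalSpace X] [ChartedSpace E3 X]

/-- `endValue` is multiplicative: `(f g)^ = f^ g^` (also on the junk region, `0 = 0 · 0`).
[folklore] -/
theorem endValue_mul (e : AFEnd X) (f g : X → ℝ) (x : E3) :
    endValue e (fun y ↦ f y * g y) x = endValue e f x * endValue e g x := by
  unfold endValue
  split_ifs <;> simp

/-- `endValue` commutes with powers: `(f ^ n)^ = (f^) ^ n` for `n ≠ 0`. [folklore] -/
theorem endValue_pow (e : AFEnd X) (f : X → ℝ) {n : ℕ} (hn : n ≠ 0) (x : E3) :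
    endValue e (fun y ↦ f y ^ n) x = endValue e f x ^ n := by
  unfold endValue
  split_ifs <;> simp [hn]

/-- A smooth function on `X` is smooth in the chart of the end: `endValue e f` is `C^∞` on the
open exterior region `{R < ‖x‖}` (composition with the smooth inverse chart `dataChart e`).
[folklore] -/
theorem contDiffOn_endValue (e : AFEnd X) {f : X → ℝ} (hf : ContMDiff (𝓡 3) 𝓘(ℝ) ∞ f) :
    ContDiffOn ℝ ∞ (endValue e f) {x | e.R < ‖x‖} := by
  intro x hx
  -- on the open subtype `exteriorRegion e.R` the function is `f ∘ dataChart e`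
  have h1 : ContMDiff (𝓡 3) 𝓘(ℝ) ∞ (fun y : exteriorRegion e.R ↦ endValue e f (y : E3)) := by
    have : (fun y : exteriorRegion e.R ↦ endValue e f (y : E3)) = f ∘ e.dataChart := by
      funext y
      exact endValue_of_lt e f y.2
    rw [this]
    exact hf.comp e.contMDiff_dataChart
  have h2 : ContMDiffAt 𝓘(ℝ, E3) 𝓘(ℝ) ∞ (endValue e f) x :=
    (contMDiffAt_subtype_iff (U := exteriorRegion e.R) (x := ⟨x, hx⟩)).1 (h1 ⟨x, hx⟩)
  exact (contMDiffAt_iff_contDiffAt.1 h2).contDiffWithinAt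

variable [IsManifold (𝓡 3) ∞ X]

/-- The chart components of the conformal data `φ⁴ h` through `endValue`: for `R < ‖x‖`,
`hCoeff e (D.conformal φ) x = (endValue e φ x)⁴ • hCoeff e D x` (`AFEnd.hCoeff_conformal` of
`PositiveMassConformal.lean`, Schoen–Yau 1979, p. 49: "on `N_k` we have
`d̃s² = φ⁴ Σ gᵢⱼ dxⁱ dxʲ`", with `φ(Φ x)` read as `endValue e φ x`). Off the ball this is also the
object `conformalCoeff e D φ x` of `ConformalFlow.lean` (`conformalCoeff_eq_endValue_pow_smul`;
that file, Bray's conformal flow, lies outside the import cone of this one).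
[cite: SchoenYauPMT1979, §2 Step 1 (p. 49)] -/
theorem AFEnd.hCoeff_conformal_eq_endValue_pow_smul (e : AFEnd X) (D : InitialDataSet (𝓡 3) X)
    (φ : X → ℝ) (hφ : ContMDiff (𝓡 3) 𝓘(ℝ) ∞ φ) (hpos : ∀ x, 0 < φ x) {x : E3}
    (hx : e.R < ‖x‖) :
    AFEnd.hCoeff e (D.conformal φ hφ hpos) x = endValue e φ x ^ 4 • AFEnd.hCoeff e D x := by
  rw [AFEnd.hCoeff_conformal e D φ hφ hpos hx, endValue_of_lt e φ hx]

end EndValue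

/-! ### The mass of `φ⁴ ds²` (proved) -/

/-- **The mass of `φ⁴ ds²`** (Schoen–Yau, Comm. Math. Phys. 65 (1979), §2, Step 1, p. 49:
"on `N_k` we have `d̃s² = φ⁴ ds² = …`. Thus the new mass of `N_k` is `M̃ = …`"; and the last
sentence of the proof of Lemma 3.3, p. 72: "The formula for `M̃` follows from Lemma 3.2", i.e.
from the expansion `φ = 1 + A/r + ω` of (3.17)–(3.18)). If in the chart of the end `e` the metric
of `D` has the expansion (1.1) with mass `M` (`IsAsymptoticallySchwarzschild e D M 2`) and the
smooth positive function `φ` satisfies `φ = 1 + A/r + O₂(r⁻²)` in the chart (`iteratedFDeriv` of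
`endValue e φ` along `Bornology.cobounded E3`), then the conformal data `φ⁴ h`
(`D.conformal φ`, `PositiveMassConformal.lean`) have the expansion (1.1) with mass `M + 2A` —
proved by the chart computation `isBigOSmooth_conformalFourth_chart` (`DecaySymbols.lean`), the
smoothness of the chart components (`AFEnd.ContDiffOn_hCoeff_holds`, `contDiffOn_endValue`) and
`hCoeff e (D.conformal φ) = (endValue e φ)⁴ • hCoeff e D` on the end.
[cite: SchoenYauPMT1979, §2 Step 1 (p. 49)] -/
theorem IsAsymptoticallySchwarzschild.conformal {X : Type} [TopologicalSpace X]
    [ChartedSpace E3 X] [IsManifold (𝓡 3) ∞ X] {e : AFEnd X} {D : InitialDataSet (𝓡 3) X}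
    {M A : ℝ} {φ : X → ℝ} (hφ : ContMDiff (𝓡 3) 𝓘(ℝ) ∞ φ) (hpos : ∀ x, 0 < φ x)
    (hD : IsAsymptoticallySchwarzschild e D M 2)
    (hexp : ∀ m : ℕ, m ≤ 2 →
      (fun x ↦ ‖iteratedFDeriv ℝ m (fun y ↦ endValue e φ y - (1 + A / ‖y‖)) x‖)
        =O[cobounded E3] fun x ↦ ‖x‖ ^ (-2 - m : ℝ)) :
    IsAsymptoticallySchwarzschild e (D.conformal φ hφ hpos) (M + 2 * A) 2 := by
  have key := (isBigOSmooth_conformalFourth_chart (innerSL ℝ : E3 →L[ℝ] E3 →L[ℝ] ℝ)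
    (e.ContDiffOn_hCoeff_holds D) (contDiffOn_endValue e hφ) hD hexp).congr_far (R₁ := e.R)
    (g := fun y ↦ AFEnd.hCoeff e (D.conformal φ hφ hpos) y -
      (1 + (M + 2 * A) / (2 * ‖y‖)) ^ 4 • (innerSL ℝ : E3 →L[ℝ] E3 →L[ℝ] ℝ))
    fun y hy ↦ by rw [e.hCoeff_conformal_eq_endValue_pow_smul D φ hφ hpos hy]
  intro m hm
  exact key.2 m hm

/-! ### Assembly: Cor. 3.1 and step 1 of the rigidity theorem from the remaining printed steps -/

/-- Strong asymptotic flatness with `M = 0`, `β = 2` to any number `nh ≥ 2` of derivatives gives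
the Schoen–Yau expansion (1.1) with `M = 0` to second order. [cite: SchoenYauPMT1979, §1 (1.1)] -/
theorem IsAsymptoticallySchwarzschild.of_isStronglyAsymptoticallyFlatWith_zero_two
    {X : Type} [TopologicalSpace X] [ChartedSpace E3 X] [IsManifold (𝓡 3) ∞ X] {e : AFEnd X}
    {D : InitialDataSet (𝓡 3) X} {γ : ℝ} {nh nk : ℕ} (hnh : 2 ≤ nh)
    (h : e.IsStronglyAsymptoticallyFlatWith D 0 2 γ nh nk) :
    IsAsymptoticallySchwarzschild e D 0 2 :=
  fun m hm ↦ IsAsymptoticallySchwarzschild.of_isStronglyAsymptoticallyFlatWith_zero h m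
    (hm.trans hnh)

/-- **The negative-mass scalar-flat conformal metric of Cor. 3.1, from the conformal factor.**
Schoen–Yau, Comm. Math. Phys. 65 (1979), proof of Lemma 3.3 and Cor. 3.1 (pp. 71–72), with the
two remaining printed ingredients as explicit hypotheses (their statements, not their proofs, are
used; neither is asserted here):

* the **conformal factor** (`hφ`, `hpos`, `hpde`, `hA`, `hexp`; Lemma 3.3 with Lemma 3.2 for
  `M = 0`, `R ≥ 0`, `R ≢ 0`): a smooth positive `φ` with `Δ_h φ = Rφ/8` ((3.22):
  "In order for the metric `φ⁴ ds²` to be scalar flat, the function `φ` must satisfy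
  `Δφ - ⅛Rφ = 0`"), and in the chart of the end `φ = 1 + A/r + ω`, `|∂^m ω| = O(r^{-2-m})` for
  `m ≤ 2` ((3.17)–(3.18) with the Schauder estimate (3.20)), where
  `A = -(1/4π) ∫_N (fv + h) √g dx = -(1/32π) ∫_N Rφ dV < 0` ((3.16); the sign is what Cor. 3.1
  asserts: "`N_k` has negative total mass");
* the **conformal scalar-curvature formula** in dimension three (`hR`; §2, Step 1, p. 49: "The
  well-known formula for the scalar curvature `R̃` [of `φ⁴ ds²`] is `R̃ = φ⁻⁵(-8Δφ + Rφ)`"), for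
  this `h` and `φ`, with `Δ_h = tr_h Hess` the prelude's `PseudoRiemannianMetric.dalembertian`
  (O'Neill 1983, Def. 3.50) and any instance of the Levi-Civita hypothesis of `φ⁴ h`.

Conclusion (the body of `exists_conformal_negativeMass_of_massZero` for these `X, D, e`): the
conformal data `D.conformal φ = (φ⁴ h, k)` (`PositiveMassConformal.lean`) — whose Levi-Civita
hypothesis is discharged by `PseudoRiemannianMetric.hasLeviCivita` — satisfy `h' = φ⁴ h`, are
asymptotically Schwarzschildean of mass `2A < 0` (the proved mass read-off
`IsAsymptoticallySchwarzschild.conformal` with `M = 0`) and scalar flat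
(`R' = φ⁻⁵ (Rφ - 8 · Rφ/8) = 0`). [cite: SchoenYauPMT1979, Cor. 3.1 (p. 72) with Lemma 3.3 and §2 Step 1 (p. 49)] -/
theorem exists_conformal_negativeMass_of_conformalFactor {X : Type} [TopologicalSpace X]
    [ChartedSpace E3 X] [IsManifold (𝓡 3) ∞ X] (D : InitialDataSet (𝓡 3) X)
    [D.metric.HasLeviCivita] (e : AFEnd X) (haf : e.IsStronglyAsymptoticallyFlatWith D 0 2 0 5 0)
    {φ : X → ℝ} {A : ℝ} (hφ : ContMDiff (𝓡 3) 𝓘(ℝ) ∞ φ) (hpos : ∀ x, 0 < φ x)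
    (hpde : ∀ x, D.metric.dalembertian φ x = D.metric.scalarCurvature x * φ x / 8) (hA : A < 0)
    (hexp : ∀ m : ℕ, m ≤ 2 →
      (fun x ↦ ‖iteratedFDeriv ℝ m (fun y ↦ endValue e φ y - (1 + A / ‖y‖)) x‖)
        =O[cobounded E3] fun x ↦ ‖x‖ ^ (-2 - m : ℝ))
    (hR : ∀ [(D.conformal φ hφ hpos).metric.HasLeviCivita] (x : X),
      (D.conformal φ hφ hpos).metric.scalarCurvature x =
        (φ x)⁻¹ ^ 5 * (D.metric.scalarCurvature x * φ x - 8 * D.metric.dalembertian φ x)) :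
    ∃ (φ' : X → ℝ) (D' : InitialDataSet (𝓡 3) X) (_ : D'.metric.HasLeviCivita) (M' : ℝ),
      (∀ x : X, 0 < φ' x) ∧
      (∀ (x : X) (v w : TangentSpace (𝓡 3) x),
        D'.metric.val x v w = φ' x ^ 4 * D.metric.val x v w) ∧
      IsAsymptoticallySchwarzschild e D' M' 2 ∧ M' < 0 ∧
      ∀ x : X, D'.metric.scalarCurvature x = 0 := by
  let D' : InitialDataSet (𝓡 3) X := D.conformal φ hφ hpos
  haveI hL : D'.metric.HasLeviCivita := D'.metric.hasLeviCivita
  refine ⟨φ, D', hL, 0 + 2 * A, hpos, fun x v w ↦ ?_, ?_, by linarith, fun x ↦ ?_⟩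
  · exact D.metric_conformal_val φ hφ hpos x v w
  · exact IsAsymptoticallySchwarzschild.conformal hφ hpos
      (IsAsymptoticallySchwarzschild.of_isStronglyAsymptoticallyFlatWith_zero_two
        (by norm_num) haf) hexp
  · rw [hR x, hpde x]
    ring

/-- **Cor. 3.1 from the remaining printed steps.** The named fact
`exists_conformal_negativeMass_of_massZero` (Schoen–Yau 1979, Cor. 3.1, p. 72) follows from the
existence of the conformal factor for every admissible `(X, h, e)` (`hφ`: Lemma 3.3 with Lemma 3.2
for `M = 0`, `R ≥ 0`, `R ≢ 0`, output `φ > 0` smooth, `Δφ = Rφ/8`, `φ = 1 + A/r + O₂(r⁻²)`,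
`A < 0`; hypotheses those of Cor. 3.1: `X` oriented, `h - δ = o₅(r⁻²)`, one end, `R ≥ 0`,
`R ≢ 0`) and the conformal scalar-curvature formula in dimension three (`hR`: p. 49), by
`exists_conformal_negativeMass_of_conformalFactor`. [cite: SchoenYauPMT1979, Cor. 3.1 (p. 72) with Lemma 3.3 and §2 Step 1 (p. 49)] -/
theorem exists_conformal_negativeMass_of_massZero_of_conformalFactor
    (hR : ∀ (X : Type) [TopologicalSpace X] [ChartedSpace E3 X] [IsManifold (𝓡 3) ∞ X]
      (D : InitialDataSet (𝓡 3) X) [D.metric.HasLeviCivita] (φ : X → ℝ)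
      (hφ : ContMDiff (𝓡 3) 𝓘(ℝ) ∞ φ) (hpos : ∀ x, 0 < φ x)
      [(D.conformal φ hφ hpos).metric.HasLeviCivita] (x : X),
      (D.conformal φ hφ hpos).metric.scalarCurvature x =
        (φ x)⁻¹ ^ 5 * (D.metric.scalarCurvature x * φ x - 8 * D.metric.dalembertian φ x))
    (hφ : ∀ (X : Type) [TopologicalSpace X] [ChartedSpace E3 X] [IsManifold (𝓡 3) ∞ X]
      [T2Space X] [SecondCountableTopology X] [ConnectedSpace X]
      (D : InitialDataSet (𝓡 3) X) [D.metric.HasLeviCivita] (e : AFEnd X),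
      Literature.Topology.FourManifolds.IsOrientable (𝓡 3) X →
      e.IsStronglyAsymptoticallyFlatWith D 0 2 0 5 0 → e.IsSoleEnd →
      (∀ x : X, 0 ≤ D.metric.scalarCurvature x) → (∃ x : X, D.metric.scalarCurvature x ≠ 0) →
      ∃ (φ : X → ℝ) (A : ℝ), ContMDiff (𝓡 3) 𝓘(ℝ) ∞ φ ∧ (∀ x, 0 < φ x) ∧
        (∀ x, D.metric.dalembertian φ x = D.metric.scalarCurvature x * φ x / 8) ∧ A < 0 ∧
        ∀ m : ℕ, m ≤ 2 →
          (fun x ↦ ‖iteratedFDeriv ℝ m (fun y ↦ endValue e φ y - (1 + A / ‖y‖)) x‖)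
            =O[cobounded E3] fun x ↦ ‖x‖ ^ (-2 - m : ℝ)) :
    exists_conformal_negativeMass_of_massZero := by
  intro X _ _ _ _ _ _ D _ e hor haf hsole hR0 hne
  obtain ⟨φ, A, hφs, hpos, hpde, hA, hexp⟩ := hφ X D e hor haf hsole hR0 hne
  exact exists_conformal_negativeMass_of_conformalFactor D e haf hφs hpos hpde hA hexp
    fun x ↦ hR X D φ hφs hpos x

/-- **Step 1 of the rigidity theorem from Thm. 1 and the remaining printed steps of Cor. 3.1**:
`scalarFlat_of_massZero` (Schoen–Yau 1979, p. 72: "Theorem 1 and Corollary 3.1 imply that an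
asymptotically flat metric satisfying the hypotheses `M = 0`, `R ≥ 0` must have `R = 0` on `N`")
from the positive mass theorem `schoenYau_mass_nonneg` (Thm. 1), the conformal
scalar-curvature formula (`hR`, p. 49) and the conformal factor of Lemmas 3.2–3.3 (`hφ`), via
`scalarFlat_of_massZero_of_facts`. [cite: SchoenYauPMT1979, Thm. 1 and Cor. 3.1 (p. 72)] -/
theorem scalarFlat_of_massZero_of_conformalFactor (h₀ : schoenYau_mass_nonneg)
    (hR : ∀ (X : Type) [TopologicalSpace X] [ChartedSpace E3 X] [IsManifold (𝓡 3) ∞ X]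
      (D : InitialDataSet (𝓡 3) X) [D.metric.HasLeviCivita] (φ : X → ℝ)
      (hφ : ContMDiff (𝓡 3) 𝓘(ℝ) ∞ φ) (hpos : ∀ x, 0 < φ x)
      [(D.conformal φ hφ hpos).metric.HasLeviCivita] (x : X),
      (D.conformal φ hφ hpos).metric.scalarCurvature x =
        (φ x)⁻¹ ^ 5 * (D.metric.scalarCurvature x * φ x - 8 * D.metric.dalembertian φ x))
    (hφ : ∀ (X : Type) [TopologicalSpace X] [ChartedSpace E3 X] [IsManifold (𝓡 3) ∞ X]
      [T2Space X] [SecondCountableTopology X] [ConnectedSpace X]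
      (D : InitialDataSet (𝓡 3) X) [D.metric.HasLeviCivita] (e : AFEnd X),
      Literature.Topology.FourManifolds.IsOrientable (𝓡 3) X →
      e.IsStronglyAsymptoticallyFlatWith D 0 2 0 5 0 → e.IsSoleEnd →
      (∀ x : X, 0 ≤ D.metric.scalarCurvature x) → (∃ x : X, D.metric.scalarCurvature x ≠ 0) →
      ∃ (φ : X → ℝ) (A : ℝ), ContMDiff (𝓡 3) 𝓘(ℝ) ∞ φ ∧ (∀ x, 0 < φ x) ∧
        (∀ x, D.metric.dalembertian φ x = D.metric.scalarCurvature x * φ x / 8) ∧ A < 0 ∧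
        ∀ m : ℕ, m ≤ 2 →
          (fun x ↦ ‖iteratedFDeriv ℝ m (fun y ↦ endValue e φ y - (1 + A / ‖y‖)) x‖)
            =O[cobounded E3] fun x ↦ ‖x‖ ^ (-2 - m : ℝ)) :
    scalarFlat_of_massZero :=
  scalarFlat_of_massZero_of_facts h₀
    (exists_conformal_negativeMass_of_massZero_of_conformalFactor hR hφ)

end Literature.Geometry.Lorentzian

end
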